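import Summits.BirchSwinnertonDyer.Rank1Residual.Additive.X4RankZeroUpperBoundThree
import Summits.BirchSwinnertonDyer.Rank1Residual.Additive.X4RankZeroTamagawaParity
import Summits.BirchSwinnertonDyer.Rank1Residual.Additive.SemistableTwistTowerThree
import Summits.BirchSwinnertonDyer.Rank1Residual.AdditivePotMult.ManinConstantDegree
import Summits.BirchSwinnertonDyer.Rank1Residual.X11b.MultiplicativeSurjectivityTwist
import HarnessLib

/-!
# X4 / X4(M), rank `0`, additive odd `p`: the `N`-IMPRIMITIVE Kim–Nakamura inequality with a DEFECT
# `Σ ord_p(ℓ − a_ℓ)` over the multiplicative primes, and the Cassels–Tate PARITY closure of the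
# defect-`≤ 1` rows (cell `b2b-bsdres`, sub-cell additive-p1, gen 18 — companion of
# `RankZeroKimNakamuraImprimitive.lean`)

HONEST FRAMING (cell `b2b-bsdres`, run/shared/lean/b2b/bsd-rank1-residual/, verbatim in every
file): the goal of the cell is to DELETE the COMBINATION-SHAPED residual classes of the
Birch–Swinnerton-Dyer formula for ALL analytic-rank `≤ 1` elliptic curves over `ℚ` — "full BSD
formula for every rank `≤ 1` curve in class `C`" assembled STRICTLY from published theorems — so
that the rank-`≤ 1` remainder becomes exactly the CONSTRUCTION-SHAPED classes, which are TYPED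
(missing-input `Prop`s), NOT attempted. This is not "finishing BSD". Sub-cell additive-p1
(X3♯(M) / X4(M): additive, potentially MULTIPLICATIVE prime) is a research route; X3♯(M) and X4(M)
stay CONSTRUCTION-SHAPED; nothing is booked by this file (the lane books, the referee signs); the
census numbers quoted are EVIDENCE pointers, never inputs. THEOREMS ONLY (no definition, no named
fact, no `sorry`).

## What this file does

Kim–Nakamura, J. Number Theory 210 (2020), Rem. 1.8 (4) (arXiv p. 4): "If we replace `L(E,1)` by the
`N`-imprimitive `L`-value `L^{(N)}(E,1)` in Theorem 1.7, then we can weaken Assumption 1.1.(1) by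
`p ∤ Tam(E)`." The cell's named fact A153 (`KimNakamura2020.rankZero_padicValNat_sha_le_of_maninConstant`,
the rank-`0` Euler-system INEQUALITY at an additive odd `p`) carries Assumption 1.1 (1) verbatim —
`p ∤ ℓ − 1` at every split and `p ∤ ℓ + 1` at every non-split multiplicative prime `ℓ` — which cuts
the (M)@3 rank-`0` population from 82 196 to 20 043 pairs (rmap-2 gen 3 `kn20_bits_rmap2g3.md`,
bit LPM). The Literature append A153′ `KimNakamura2020.rankZero_padicValNat_sha_le_imprimitive_of_maninConstant`
(this sub-cell, gen 18, p326400; §3.1 / Thm. 3.1 normalisation `exp*(c_ℚ(1)) = L^{(Np)}(E,1)/Ω⁺_E ω_E`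
read through the same Thm. 4.2 (2) + (4.3) + Cor. 2.4) drops that clause at the price of the DEFECT
`Σ_{ℓ ∣ N_st} ord_p(ℓ − 1) + Σ_{ℓ ∣ N_ns} ord_p(ℓ + 1) = ord_p(L^{(N)}(E,1)/L(E,1))` in the bound
(typed: any finite `S ⊇` multiplicative primes, any `d` bounding the local terms, `+ Σ_{ℓ ∈ S} d ℓ`).

§4 `padicValNat_shaOrder_le_defect_of_kimNakamuraImprimitive_rankZero` (class-agnostic, any additive
odd `p`, `7 < p` or non-exceptional): `ord_p #Ш ≤ ord_p #Ш_an + ord_p ∏c_ℓ − 2 ord_p #tors + Σ_{ℓ ∈ S} d ℓ`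
(the port of additive-p4's `padicValNat_shaOrder_le_of_kimNakamura_rankZero` with the defect).
PARITY (class X4: additive, `E[p]` irreducible): when the defect is `≤ 1` — AT MOST ONE multiplicative
`ℓ` with `p ∣ ℓ − a_ℓ(E)`, and `p² ∤ ℓ − a_ℓ(E)` for it — the Cassels–Tate squareness of `#Ш` (bsd.S18,
`isSquare_shaOrder_of_casselsTate`) turns `ord_p #Ш ≤ ord_p #Ш_an + 1` into `BSD(E,p)` on the unit rows
(`X4RankZero.bsdp_of_kimNakamuraImprimitive_of_casselsTate_of_defect_le_one_of_shaAn_unit`) and on the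
`ord_p #Ш_an = 2k` rows carrying ONE certificate `p^{2k−1} ∣ #Ш(E)`
(`X4RankZero.bsdp_of_kimNakamuraImprimitive_of_casselsTate_of_pow_dvd_of_defect_le_one`) — the same
parity mechanism as the cell's Tamagawa-defect closures (`Additive/X4RankZeroTamagawaParity.lean`,
V23X `T-KATO-CT3`), now for the Euler-factor defect.
§5 X4(M) at `p = 3`: the tower binder discharged by `ClassX4M.towerSurj_of_surj` (surj(3) alone —
Wuthrich Lemma 20 PROVED on the multiplicative twist, n1011-p14) or by `3 ∤ ord₃ j`
(`ClassX4M.surj_of_not_dvd_padicValRat_j`), the Manin binder by `3 ∤ deg φ`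
(`ClassX4M.not_dvd_maninConstant_of_not_dvd_modularDegree`, CNS 2024 `hCNS` + tameness):
`ClassX4M.bsdp_three_rankZero_of_kimNakamuraImprimitive_of_surj_of_defect_le_one_of_shaAn_unit`, `…_of_not_dvd_padicValRat_j_…`,
`…_of_not_dvd_modularDegree_…`, `…_of_casselsTate_of_pow_dvd_of_defect_le_one`.

CENSUS (EVIDENCE only; `HOME/b2b-bsdres-additive-p1/census-g18/KN20-IMPRIMITIVE-M3.md`, base S-b v4f,
bit definitions shared with rmap-2 gen 3 `kn20_bits_rmap2g3.py`, whose M3 totals it reproduces digit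
for digit — 82 196 / LPM 20 043 / NEXC 41 205): the imprimitive defect on the 82 196 (M)@3 `r = 0`
pairs is `D = 0` on 20 043, `D = 1` on 26 640, `D ≥ 2` on 35 513; with surj(3) ∧ `3 ∤ ∏c_ℓ` ∧
non-exceptional ∧ `3 ∤ #Ш_an`: `D = 0` 7 562 pairs (A153, companion file), `D ≤ 1` 17 865 pairs (this
file; 10 303 NEW), plus 996 `ord₃ #Ш_an = 2` pairs with `D ≤ 1` closable by ONE `Ш[3] ≠ 0` certificate
— all PMX-booked LITERAL today. What this is NOT: not a class theorem; not flag-free (A153′ is a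
READING-fact resting on Rem. 1.8 (1) + (4): proposed flags `KN20-p≤7-by-Remark-1.8(1)`,
`KN20-inequality-packaging`, `KN20-imprimitive-by-Remark-1.8(4)`); nothing booked.

References: Kim–Nakamura 2020 [KimNakamura2020] Rem. 1.8 (1)(4), Thm. 1.7, §3.1 / Thm. 3.1, Thm. 4.2 (2),
(4.3), Cor. 2.4, Assumption 1.1 / 2.5; Wuthrich 2014 [Wuthrich2014] Lemma 20 (p. 399);
Česnavičius–Neururer–Saha 2024 [CesnaviciusNeururerSaha2023] Thm. 1.2; Silverman *AEC* X.4.14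
(Cassels–Tate), *ATAEC* V.5.3 / V.6.1; Miller 2011 [Miller2011LMS] Def. 1.1; Gross–Zagier–Kolyvagin
(bsd.S17); modularity (BCDT).
-/

noncomputable section

open scoped Classical

open WeierstrassCurve Literature.NumberTheory.EllipticCurves
  Literature.NumberTheory.EllipticCurves.ModularForms
  Literature.NumberTheory.EllipticCurves.Rank1Residual
  Literature.NumberTheory.EllipticCurves.Rank1Residual.Typed

namespace Summit.BirchSwinnertonDyer.Rank1Residual.AdditivePotMult

section Imprimitive

open Additive GaloisImage

/-! ### §4 The `N`-imprimitive Kim–Nakamura inequality with a DEFECT, class-agnostic -/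

/-- **Rank `0`, ADDITIVE odd `p` (non-exceptional or `p > 7`), `ρ̄_{E,pⁿ}` onto for all `n`, `p ∤ ∏ c_ℓ`,
`p ∤ c_D`: `ord_p #Ш(E) ≤ ord_p #Ш(E)_an + ord_p ∏ c_ℓ − 2 ord_p #E(ℚ)_tors + Σ_{ℓ ∈ S} d ℓ`** for
ANY finite `S` containing the multiplicative primes and ANY `d` with `ord_p(ℓ − 1) ≤ d ℓ` (split) /
`ord_p(ℓ + 1) ≤ d ℓ` (non-split) — the `N`-IMPRIMITIVE Kim–Nakamura inequality (Rem. 1.8 (4), named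
fact `hKNI` = A153′) rewritten from `L(E,1)/Ω` to `#Ш_an` by the rank-`0` BSD bookkeeping
(`#Ш_an = L(E,1)·#tors² / (Ω·∏c_ℓ)`, regulator `1`), class-agnostic; the port of additive-p4's
`padicValNat_shaOrder_le_of_kimNakamura_rankZero` with the `(ℓ ∓ 1)` clause REPLACED by the defect.
[cite: KimNakamura2020, Rem. 1.8 (4) and Rem. 1.8 (1) with Thm. 1.7 (arXiv p. 4); §3.1 and Thm. 3.1 (arXiv p. 7); Thm. 4.2 (2), (4.3) (arXiv p. 9)]
[cite: Miller2011LMS, Def. 1.1] -/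
theorem padicValNat_shaOrder_le_defect_of_kimNakamuraImprimitive_rankZero
    (W : WeierstrassCurve ℚ) [W.IsElliptic] [W.IsGloballyMinimal] (p : ℕ) [Fact p.Prime]
    (hKNI : KimNakamura2020.rankZero_padicValNat_sha_le_imprimitive_of_maninConstant)
    (hGZK : rank_eq_analyticRank_of_analyticRank_le_one) (hmod : hasEntireLFunction_rat)
    (hp2 : p ≠ 2) (hadd : ¬ W.HasGoodReductionAtPrime p ∧ ¬ W.HasMultiplicativeReductionAtPrime p)
    (hexc : 7 < p ∨ KimNakamura2020.NonExceptional W p)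
    (hr : W.analyticRank = 0) (hsurj : ∀ n : ℕ, W.HasSurjectiveModNGaloisRep (p ^ n : ℕ))
    (htam : ¬ p ∣ W.tamagawaProduct)
    {N : ℕ} [NeZero N] (D : ModularParametrizationData W N) (hc : ¬ (p : ℤ) ∣ D.maninConstant)
    (S : Finset ℕ) (d : ℕ → ℕ)
    (hS : ∀ (ℓ : ℕ) [Fact ℓ.Prime], W.HasMultiplicativeReductionAtPrime ℓ →
      ℓ ∈ S ∧ (W.HasSplitMultiplicativeReductionAtPrime ℓ → padicValNat p (ℓ - 1) ≤ d ℓ) ∧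
        (¬ W.HasSplitMultiplicativeReductionAtPrime ℓ → padicValNat p (ℓ + 1) ≤ d ℓ)) :
    ∃ q : ℚ, shaAn W = (q : ℂ) ∧
      (padicValNat p W.shaOrder : ℤ) ≤
        padicValRat p q + padicValNat p W.tamagawaProduct - 2 * padicValNat p W.torsionOrder +
          ∑ ℓ ∈ S, (d ℓ : ℤ) := by
  have hL : W.entireLFunction 1 ≠ 0 := (W.analyticRank_eq_zero_iff_holds (hmod W)).mp hr
  obtain ⟨hmw, hfin⟩ := hGZK W (by rw [hr]; exact zero_le_one)
  haveI : Finite W.sha := hfin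
  have hmw0 : W.mordellWeilRank = 0 := by rw [hmw, hr]
  obtain ⟨q₀, hq₀, hle⟩ := hKNI W p hp2 hadd.1 hadd.2 hexc hsurj htam hL hfin D hc S d hS
  have hΩpos : 0 < W.realPeriodRat := W.realPeriodRat_pos_holds
  have hΩ : (W.realPeriodRat : ℂ) ≠ 0 := by exact_mod_cast hΩpos.ne'
  have hc0 : 0 < W.tamagawaProduct := W.tamagawaProduct_pos_holds
  have ht0 : 0 < W.torsionOrder := W.torsionOrder_pos_holds
  have hq₀0 : q₀ ≠ 0 := by
    rintro rfl
    rw [Rat.cast_zero, div_eq_zero_iff] at hq₀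
    exact hq₀.elim hL hΩ
  refine ⟨q₀ * (W.torsionOrder : ℚ) ^ 2 / (W.tamagawaProduct : ℚ), ?_, ?_⟩
  · have hcp : (W.tamagawaProduct : ℂ) ≠ 0 := by exact_mod_cast hc0.ne'
    have hLq : W.entireLFunction 1 = (q₀ : ℂ) * (W.realPeriodRat : ℂ) := by
      rw [← hq₀, div_mul_cancel₀ _ hΩ]
    rw [shaAn_def, leadingLCoeff_eq_of_analyticRank_eq_zero W hr,
      W.regulator_eq_one_of_rank_zero hmw0, hLq]
    push_cast
    field_simp
  · have ht : (W.torsionOrder : ℚ) ≠ 0 := by exact_mod_cast ht0.ne'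
    have hcq : (W.tamagawaProduct : ℚ) ≠ 0 := by exact_mod_cast hc0.ne'
    have hsha : padicValNat p (Nat.card (AddCommGroup.primaryComponent W.sha p)) =
        padicValNat p W.shaOrder := by
      unfold WeierstrassCurve.shaOrder
      exact padicValNat_card_addPrimaryComponent p
    have hv : padicValRat p (q₀ * (W.torsionOrder : ℚ) ^ 2 / (W.tamagawaProduct : ℚ)) =
        padicValRat p q₀ + 2 * (padicValNat p W.torsionOrder : ℤ) -
          (padicValNat p W.tamagawaProduct : ℤ) := by
      rw [padicValRat.div (mul_ne_zero hq₀0 (pow_ne_zero 2 ht)) hcq,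
        padicValRat.mul hq₀0 (pow_ne_zero 2 ht), pow_two, padicValRat.mul ht ht,
        padicValRat.of_nat, padicValRat.of_nat]
      ring
    rw [hv, ← hsha]
    linarith

/-- **Cassels–Tate PARITY closes the defect-`≤ 1` unit rows, class X4, any ADDITIVE odd `p`.** Let
`E/ℚ` be globally minimal, `p ≠ 2`, `E` in class X4 at `p` (additive, `E[p]` irreducible),
`r_an = 0`, `ρ̄_{E,pⁿ}` onto for all `n`, non-exceptional (or `p > 7`), `p ∤ ∏ c_ℓ`, `p ∤ c_D`, and
let the imprimitive defect satisfy `Σ_{ℓ ∈ S} d ℓ ≤ 1` — i.e. AT MOST ONE multiplicative prime `ℓ`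
with `p ∣ ℓ − a_ℓ(E)`, and for it `p² ∤ ℓ − a_ℓ(E)`. If `#Ш(E)_an` is a `p`-unit then `BSD(E,p)`:
§4 gives `ord_p #Ш ≤ 1`, Cassels–Tate squareness (`hCT` = bsd.S18, `isSquare_shaOrder_of_casselsTate`)
makes it even, hence `0 = ord_p #Ш_an`. The NEW rows relative to A153 are those with defect EXACTLY `1`
(one multiplicative `ℓ ≡ a_ℓ (mod p)`, `≢ (mod p²)`), excluded by Assumption 1.1 (1) as printed.
[cite: KimNakamura2020, Rem. 1.8 (4) and Rem. 1.8 (1) with Thm. 1.7 (arXiv p. 4)]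
[cite: SilvermanAEC2009, Thm. X.4.14] [cite: Miller2011LMS, §1 and Def. 1.1] -/
theorem X4RankZero.bsdp_of_kimNakamuraImprimitive_of_casselsTate_of_defect_le_one_of_shaAn_unit
    (W : WeierstrassCurve ℚ) [W.IsElliptic] [W.IsGloballyMinimal] (p : ℕ) [Fact p.Prime]
    (hKNI : KimNakamura2020.rankZero_padicValNat_sha_le_imprimitive_of_maninConstant)
    (hGZK : rank_eq_analyticRank_of_analyticRank_le_one) (hmod : hasEntireLFunction_rat)
    (hCT : exists_casselsTate_pairing (K := ℚ))
    (hX : ClassX4 W p) (hexc : 7 < p ∨ KimNakamura2020.NonExceptional W p)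
    (hr : W.analyticRank = 0) (hsurj : ∀ n : ℕ, W.HasSurjectiveModNGaloisRep (p ^ n : ℕ))
    (htam : ¬ p ∣ W.tamagawaProduct)
    {N : ℕ} [NeZero N] (D : ModularParametrizationData W N) (hc : ¬ (p : ℤ) ∣ D.maninConstant)
    (S : Finset ℕ) (d : ℕ → ℕ)
    (hS : ∀ (ℓ : ℕ) [Fact ℓ.Prime], W.HasMultiplicativeReductionAtPrime ℓ →
      ℓ ∈ S ∧ (W.HasSplitMultiplicativeReductionAtPrime ℓ → padicValNat p (ℓ - 1) ≤ d ℓ) ∧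
        (¬ W.HasSplitMultiplicativeReductionAtPrime ℓ → padicValNat p (ℓ + 1) ≤ d ℓ))
    (hd : ∑ ℓ ∈ S, d ℓ ≤ 1) {q : ℚ} (hq : shaAn W = (q : ℂ)) (hv : padicValRat p q = 0) :
    BSDp W p := by
  have hfin : W.ShaFinite := (hGZK W (by rw [hr]; exact zero_le_one)).2
  have hsq : IsSquare W.shaOrder := isSquare_shaOrder_of_casselsTate hCT W hfin
  have hn : W.shaOrder ≠ 0 := (WeierstrassCurve.shaOrder_pos W hfin).ne'
  obtain ⟨q', hq', hle⟩ := padicValNat_shaOrder_le_defect_of_kimNakamuraImprimitive_rankZero W p hKNI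
    hGZK hmod hX.1 hX.2.1 hexc hr hsurj htam D hc S d hS
  have hqq : q' = q := by exact_mod_cast hq'.symm.trans hq
  subst hqq
  rw [padicValNat_torsionOrder_eq_zero_of_irreducible W p hX.2.2, padicValNat.eq_zero_of_not_dvd htam,
    hv] at hle
  have hd' : (∑ ℓ ∈ S, (d ℓ : ℤ)) ≤ 1 := by exact_mod_cast hd
  have hle1 : padicValNat p W.shaOrder ≤ 1 := by
    have : (padicValNat p W.shaOrder : ℤ) ≤ 1 := by
      simp only [Nat.cast_zero, mul_zero, sub_zero, zero_add, add_zero] at hle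
      linarith
    exact_mod_cast this
  have h0 : padicValNat p W.shaOrder = 0 := padicValNat_eq_zero_of_isSquare_of_le_one hsq hn hle1
  exact bsdp_of_missingPPartAt W p hGZK (by rw [hr]; exact zero_le_one)
    ⟨q', hq', by rw [hv, h0, Nat.cast_zero]⟩

/-- **The `p ∣ #Ш_an` rows with ONE descent certificate and defect `≤ 1`, class X4, additive odd `p`:**
`ord_p #Ш_an = 2k`, `p^{2k−1} ∣ #Ш(E)`, `Σ_{ℓ ∈ S} d ℓ ≤ 1` (with the §4 binders) ⟹ `BSD(E,p)` —
§4 gives `ord_p #Ш ≤ 2k + 1`, the certificate and squareness give `2k ≤ ord_p #Ш` even, so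
`ord_p #Ш = 2k`. [cite: KimNakamura2020, Rem. 1.8 (4) and Rem. 1.8 (1) with Thm. 1.7 (arXiv p. 4)]
[cite: SilvermanAEC2009, Thm. X.4.14] [cite: Miller2011LMS, §1 and Def. 1.1] -/
theorem X4RankZero.bsdp_of_kimNakamuraImprimitive_of_casselsTate_of_pow_dvd_of_defect_le_one
    (W : WeierstrassCurve ℚ) [W.IsElliptic] [W.IsGloballyMinimal] (p : ℕ) [Fact p.Prime]
    (hKNI : KimNakamura2020.rankZero_padicValNat_sha_le_imprimitive_of_maninConstant)
    (hGZK : rank_eq_analyticRank_of_analyticRank_le_one) (hmod : hasEntireLFunction_rat)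
    (hCT : exists_casselsTate_pairing (K := ℚ))
    (hX : ClassX4 W p) (hexc : 7 < p ∨ KimNakamura2020.NonExceptional W p)
    (hr : W.analyticRank = 0) (hsurj : ∀ n : ℕ, W.HasSurjectiveModNGaloisRep (p ^ n : ℕ))
    (htam : ¬ p ∣ W.tamagawaProduct)
    {N : ℕ} [NeZero N] (D : ModularParametrizationData W N) (hc : ¬ (p : ℤ) ∣ D.maninConstant)
    (S : Finset ℕ) (d : ℕ → ℕ)
    (hS : ∀ (ℓ : ℕ) [Fact ℓ.Prime], W.HasMultiplicativeReductionAtPrime ℓ →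
      ℓ ∈ S ∧ (W.HasSplitMultiplicativeReductionAtPrime ℓ → padicValNat p (ℓ - 1) ≤ d ℓ) ∧
        (¬ W.HasSplitMultiplicativeReductionAtPrime ℓ → padicValNat p (ℓ + 1) ≤ d ℓ))
    (hd : ∑ ℓ ∈ S, d ℓ ≤ 1) {q : ℚ} (hq : shaAn W = (q : ℂ)) {k : ℕ}
    (hv : padicValRat p q = 2 * k) (hdvd : p ^ (2 * k - 1) ∣ W.shaOrder) : BSDp W p := by
  have hfin : W.ShaFinite := (hGZK W (by rw [hr]; exact zero_le_one)).2
  have hsq : IsSquare W.shaOrder := isSquare_shaOrder_of_casselsTate hCT W hfin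
  have hn : W.shaOrder ≠ 0 := (WeierstrassCurve.shaOrder_pos W hfin).ne'
  obtain ⟨q', hq', hle⟩ := padicValNat_shaOrder_le_defect_of_kimNakamuraImprimitive_rankZero W p hKNI
    hGZK hmod hX.1 hX.2.1 hexc hr hsurj htam D hc S d hS
  have hqq : q' = q := by exact_mod_cast hq'.symm.trans hq
  subst hqq
  rw [padicValNat_torsionOrder_eq_zero_of_irreducible W p hX.2.2, padicValNat.eq_zero_of_not_dvd htam,
    hv] at hle
  have hd' : (∑ ℓ ∈ S, (d ℓ : ℤ)) ≤ 1 := by exact_mod_cast hd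
  have hup : padicValNat p W.shaOrder ≤ 2 * k + 1 := by
    have : (padicValNat p W.shaOrder : ℤ) ≤ 2 * k + 1 := by
      simp only [Nat.cast_zero, mul_zero, sub_zero, add_zero] at hle
      linarith
    exact_mod_cast this
  have hlow : 2 * k ≤ padicValNat p W.shaOrder :=
    two_mul_le_padicValNat_of_isSquare_of_pow_dvd hsq hn hdvd
  have heq : padicValNat p W.shaOrder = 2 * k := by
    obtain ⟨r, hr2⟩ := hsq
    have hr0 : r ≠ 0 := fun h => hn (by simp [hr2, h])
    rw [hr2, padicValNat.mul hr0 hr0] at hup hlow ⊢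
    omega
  exact bsdp_of_missingPPartAt W p hGZK (by rw [hr]; exact zero_le_one)
    ⟨q', hq', by rw [hv, heq]; push_cast; ring⟩

/-! ### §5 X4(M) at `p = 3`: the imprimitive road with tower and Manin discharged -/

variable {W : WeierstrassCurve ℚ} [W.IsElliptic] [W.IsGloballyMinimal]

/-- **X4(M) ∧ surj(3) ∧ `r_an = 0`, defect `≤ 1`, unit rows ⟹ `BSD(E,3)`** — per-pair binders: NOT
exceptional, `3 ∤ ∏ c_ℓ`, `3 ∤ c_D`, a finite `S ⊇` multiplicative primes with `d`-bounds on
`ord₃(ℓ ∓ 1)` summing to `≤ 1`, `3 ∤ #Ш_an`; the `3`-adic tower from surj(3) alone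
(`ClassX4M.towerSurj_of_surj`). Inputs: `hKNI` (A153′, Rem. 1.8 (4)), `hCT`, GZK, modularity.
[cite: KimNakamura2020, Rem. 1.8 (4) and Rem. 1.8 (1) with Thm. 1.7 (arXiv p. 4)] [cite: Wuthrich2014, Lemma 20 (p. 399)]
[cite: SilvermanAEC2009, Thm. X.4.14] [cite: Miller2011LMS, §1 and Def. 1.1] -/
theorem ClassX4M.bsdp_three_rankZero_of_kimNakamuraImprimitive_of_surj_of_defect_le_one_of_shaAn_unit
    (hKNI : KimNakamura2020.rankZero_padicValNat_sha_le_imprimitive_of_maninConstant)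
    (hGZK : rank_eq_analyticRank_of_analyticRank_le_one) (hmod : hasEntireLFunction_rat)
    (hCT : exists_casselsTate_pairing (K := ℚ))
    (hX : ClassX4M W 3) (hsurj : Surj W 3) (hr : W.analyticRank = 0)
    (hexc : KimNakamura2020.NonExceptional W 3) (htam : ¬ 3 ∣ W.tamagawaProduct)
    {N : ℕ} [NeZero N] (D : ModularParametrizationData W N) (hc : ¬ (3 : ℤ) ∣ D.maninConstant)
    (S : Finset ℕ) (d : ℕ → ℕ)
    (hS : ∀ (ℓ : ℕ) [Fact ℓ.Prime], W.HasMultiplicativeReductionAtPrime ℓ →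
      ℓ ∈ S ∧ (W.HasSplitMultiplicativeReductionAtPrime ℓ → padicValNat 3 (ℓ - 1) ≤ d ℓ) ∧
        (¬ W.HasSplitMultiplicativeReductionAtPrime ℓ → padicValNat 3 (ℓ + 1) ≤ d ℓ))
    (hd : ∑ ℓ ∈ S, d ℓ ≤ 1) {q : ℚ} (hq : shaAn W = (q : ℂ)) (hv : padicValRat 3 q = 0) :
    BSDp W 3 :=
  haveI : Fact (Nat.Prime 3) := ⟨Nat.prime_three⟩
  X4RankZero.bsdp_of_kimNakamuraImprimitive_of_casselsTate_of_defect_le_one_of_shaAn_unit W 3 hKNI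
    hGZK hmod hCT hX.classX4 (Or.inr hexc) hr (ClassX4M.towerSurj_of_surj hX hsurj) htam D hc S d hS
    hd hq hv

/-- **§5, `j`-form** (surj(3) ⇐ `3 ∤ ord₃ j`). [cite: KimNakamura2020, Rem. 1.8 (4) and Rem. 1.8 (1) with Thm. 1.7 (arXiv p. 4)]
[cite: SilvermanATAEC1994, V.6 Prop. 6.1 (p. 410) and V.5.3] [cite: SilvermanAEC2009, Thm. X.4.14]
[cite: Miller2011LMS, §1 and Def. 1.1] -/
theorem ClassX4M.bsdp_three_rankZero_of_kimNakamuraImprimitive_of_not_dvd_padicValRat_j_of_defect_le_one_of_shaAn_unit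
    (hKNI : KimNakamura2020.rankZero_padicValNat_sha_le_imprimitive_of_maninConstant)
    (hGZK : rank_eq_analyticRank_of_analyticRank_le_one) (hmod : hasEntireLFunction_rat)
    (hCT : exists_casselsTate_pairing (K := ℚ))
    (hX : ClassX4M W 3) (hj : ¬ (3 : ℤ) ∣ padicValRat 3 W.j) (hr : W.analyticRank = 0)
    (hexc : KimNakamura2020.NonExceptional W 3) (htam : ¬ 3 ∣ W.tamagawaProduct)
    {N : ℕ} [NeZero N] (D : ModularParametrizationData W N) (hc : ¬ (3 : ℤ) ∣ D.maninConstant)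
    (S : Finset ℕ) (d : ℕ → ℕ)
    (hS : ∀ (ℓ : ℕ) [Fact ℓ.Prime], W.HasMultiplicativeReductionAtPrime ℓ →
      ℓ ∈ S ∧ (W.HasSplitMultiplicativeReductionAtPrime ℓ → padicValNat 3 (ℓ - 1) ≤ d ℓ) ∧
        (¬ W.HasSplitMultiplicativeReductionAtPrime ℓ → padicValNat 3 (ℓ + 1) ≤ d ℓ))
    (hd : ∑ ℓ ∈ S, d ℓ ≤ 1) {q : ℚ} (hq : shaAn W = (q : ℂ)) (hv : padicValRat 3 q = 0) :
    BSDp W 3 :=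
  haveI : Fact (Nat.Prime 3) := ⟨Nat.prime_three⟩
  hX.bsdp_three_rankZero_of_kimNakamuraImprimitive_of_surj_of_defect_le_one_of_shaAn_unit hKNI hGZK
    hmod hCT (ClassX4M.surj_of_not_dvd_padicValRat_j hX (by exact_mod_cast hj)) hr hexc htam D hc S d
    hS hd hq hv

/-- **§5, Manin-free form** (`3 ∤ deg φ` for any conductor-level parametrisation; `hCNS` = A159 +
tameness of (M)). [cite: CesnaviciusNeururerSaha2023, Thm. 1.2]
[cite: KimNakamura2020, Rem. 1.8 (4) and Rem. 1.8 (1) with Thm. 1.7 (arXiv p. 4)] [cite: SilvermanAEC2009, Thm. X.4.14]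
[cite: Miller2011LMS, §1 and Def. 1.1] -/
theorem ClassX4M.bsdp_three_rankZero_of_kimNakamuraImprimitive_of_surj_of_not_dvd_modularDegree_of_defect_le_one_of_shaAn_unit
    (hKNI : KimNakamura2020.rankZero_padicValNat_sha_le_imprimitive_of_maninConstant)
    (hCNS : cesnaviciusNeururerSaha_padicVal_maninConstant_le_modularDegree)
    (hGZK : rank_eq_analyticRank_of_analyticRank_le_one) (hmod : hasEntireLFunction_rat)
    (hCT : exists_casselsTate_pairing (K := ℚ))
    (hX : ClassX4M W 3) (hsurj : Surj W 3) (hr : W.analyticRank = 0)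
    (hexc : KimNakamura2020.NonExceptional W 3) (htam : ¬ 3 ∣ W.tamagawaProduct)
    [NeZero (W.conductorNorm ℤ)] (D : ModularParametrizationData W (W.conductorNorm ℤ))
    (hdeg : ¬ 3 ∣ D.modularDegree) (S : Finset ℕ) (d : ℕ → ℕ)
    (hS : ∀ (ℓ : ℕ) [Fact ℓ.Prime], W.HasMultiplicativeReductionAtPrime ℓ →
      ℓ ∈ S ∧ (W.HasSplitMultiplicativeReductionAtPrime ℓ → padicValNat 3 (ℓ - 1) ≤ d ℓ) ∧
        (¬ W.HasSplitMultiplicativeReductionAtPrime ℓ → padicValNat 3 (ℓ + 1) ≤ d ℓ))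
    (hd : ∑ ℓ ∈ S, d ℓ ≤ 1) {q : ℚ} (hq : shaAn W = (q : ℂ)) (hv : padicValRat 3 q = 0) :
    BSDp W 3 :=
  haveI : Fact (Nat.Prime 3) := ⟨Nat.prime_three⟩
  hX.bsdp_three_rankZero_of_kimNakamuraImprimitive_of_surj_of_defect_le_one_of_shaAn_unit hKNI hGZK
    hmod hCT hsurj hr hexc htam D (ClassX4M.not_dvd_maninConstant_of_not_dvd_modularDegree hCNS D hX hdeg)
    S d hS hd hq hv

/-- **X4(M) ∧ surj(3) ∧ `r_an = 0`, the `3 ∣ #Ш_an` rows, imprimitive road: `ord₃ #Ш_an = 2k`, ONE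
descent certificate `3^{2k−1} ∣ #Ш(E)`, defect `≤ 1` ⟹ `BSD(E,3)`.**
[cite: KimNakamura2020, Rem. 1.8 (4) and Rem. 1.8 (1) with Thm. 1.7 (arXiv p. 4)] [cite: SilvermanAEC2009, Thm. X.4.14]
[cite: Miller2011LMS, §1 and Def. 1.1] -/
theorem ClassX4M.bsdp_three_rankZero_of_kimNakamuraImprimitive_of_surj_of_casselsTate_of_pow_dvd_of_defect_le_one
    (hKNI : KimNakamura2020.rankZero_padicValNat_sha_le_imprimitive_of_maninConstant)
    (hGZK : rank_eq_analyticRank_of_analyticRank_le_one) (hmod : hasEntireLFunction_rat)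
    (hCT : exists_casselsTate_pairing (K := ℚ))
    (hX : ClassX4M W 3) (hsurj : Surj W 3) (hr : W.analyticRank = 0)
    (hexc : KimNakamura2020.NonExceptional W 3) (htam : ¬ 3 ∣ W.tamagawaProduct)
    {N : ℕ} [NeZero N] (D : ModularParametrizationData W N) (hc : ¬ (3 : ℤ) ∣ D.maninConstant)
    (S : Finset ℕ) (d : ℕ → ℕ)
    (hS : ∀ (ℓ : ℕ) [Fact ℓ.Prime], W.HasMultiplicativeReductionAtPrime ℓ →
      ℓ ∈ S ∧ (W.HasSplitMultiplicativeReductionAtPrime ℓ → padicValNat 3 (ℓ - 1) ≤ d ℓ) ∧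
        (¬ W.HasSplitMultiplicativeReductionAtPrime ℓ → padicValNat 3 (ℓ + 1) ≤ d ℓ))
    (hd : ∑ ℓ ∈ S, d ℓ ≤ 1) {q : ℚ} (hq : shaAn W = (q : ℂ)) {k : ℕ}
    (hv : padicValRat 3 q = 2 * k) (hdvd : 3 ^ (2 * k - 1) ∣ W.shaOrder) : BSDp W 3 :=
  haveI : Fact (Nat.Prime 3) := ⟨Nat.prime_three⟩
  X4RankZero.bsdp_of_kimNakamuraImprimitive_of_casselsTate_of_pow_dvd_of_defect_le_one W 3 hKNI hGZK
    hmod hCT hX.classX4 (Or.inr hexc) hr (ClassX4M.towerSurj_of_surj hX hsurj) htam D hc S d hS hd hq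
    hv hdvd

/-! ### §6 The imprimitive Cassels–Tate certificate road, MANIN-FREE (one-declaration twin of §5's
`…_of_casselsTate_of_pow_dvd_of_defect_le_one` for the lane's DEG door; referee A R233.4 (a), 2026-08-22) -/

/-- **X4(M) ∧ surj(3) ∧ `r_an = 0`, the `3 ∣ #Ш_an` rows, imprimitive road, MANIN-FREE: `ord₃ #Ш_an
= 2k`, ONE descent certificate `3^{2k−1} ∣ #Ш(E)`, defect `Σ_{ℓ ∈ S} d ℓ ≤ 1`, and `3 ∤ deg φ` for a
CONDUCTOR-LEVEL parametrisation datum `D` in place of `3 ∤ c_D` ⟹ `BSD(E,3)`.** The composition of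
`ClassX4M.bsdp_three_rankZero_of_kimNakamuraImprimitive_of_surj_of_casselsTate_of_pow_dvd_of_defect_le_one`
(A153′ `hKNI` + Cassels–Tate `hCT` twice: parity on the defect and squareness on the certificate) with
`ClassX4M.not_dvd_maninConstant_of_not_dvd_modularDegree` (Česnavičius–Neururer–Saha 2024 Thm. 1.2
`hCNS` = A159 + tameness of (M)), written out as ONE declaration so that a lane row
`T-KN20I-CT-LOW` with the DEG door names a single kernel consumer (referee A R233.4 (a)). Binders
otherwise verbatim those of the MAN-door consumer.
[cite: KimNakamura2020, Rem. 1.8 (4) and Rem. 1.8 (1) with Thm. 1.7 (arXiv p. 4); §6.3 Def. 6.20, Lemma 6.21 (arXiv pp. 15–16)]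
[cite: CesnaviciusNeururerSaha2023, Thm. 1.2] [cite: SilvermanAEC2009, Thm. X.4.14] [cite: Miller2011LMS, §1 and Def. 1.1] -/
theorem ClassX4M.bsdp_three_rankZero_of_kimNakamuraImprimitive_of_surj_of_casselsTate_of_pow_dvd_of_defect_le_one_of_not_dvd_modularDegree
    (hKNI : KimNakamura2020.rankZero_padicValNat_sha_le_imprimitive_of_maninConstant)
    (hCNS : cesnaviciusNeururerSaha_padicVal_maninConstant_le_modularDegree)
    (hGZK : rank_eq_analyticRank_of_analyticRank_le_one) (hmod : hasEntireLFunction_rat)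
    (hCT : exists_casselsTate_pairing (K := ℚ))
    (hX : ClassX4M W 3) (hsurj : Surj W 3) (hr : W.analyticRank = 0)
    (hexc : KimNakamura2020.NonExceptional W 3) (htam : ¬ 3 ∣ W.tamagawaProduct)
    [NeZero (W.conductorNorm ℤ)] (D : ModularParametrizationData W (W.conductorNorm ℤ))
    (hdeg : ¬ 3 ∣ D.modularDegree) (S : Finset ℕ) (d : ℕ → ℕ)
    (hS : ∀ (ℓ : ℕ) [Fact ℓ.Prime], W.HasMultiplicativeReductionAtPrime ℓ →
      ℓ ∈ S ∧ (W.HasSplitMultiplicativeReductionAtPrime ℓ → padicValNat 3 (ℓ - 1) ≤ d ℓ) ∧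
        (¬ W.HasSplitMultiplicativeReductionAtPrime ℓ → padicValNat 3 (ℓ + 1) ≤ d ℓ))
    (hd : ∑ ℓ ∈ S, d ℓ ≤ 1) {q : ℚ} (hq : shaAn W = (q : ℂ)) {k : ℕ}
    (hv : padicValRat 3 q = 2 * k) (hdvd : 3 ^ (2 * k - 1) ∣ W.shaOrder) : BSDp W 3 :=
  hX.bsdp_three_rankZero_of_kimNakamuraImprimitive_of_surj_of_casselsTate_of_pow_dvd_of_defect_le_one
    hKNI hGZK hmod hCT hsurj hr hexc htam D
    (ClassX4M.not_dvd_maninConstant_of_not_dvd_modularDegree hCNS D hX hdeg) S d hS hd hq hv hdvd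

/-- The same with surj(3) DECIDED by `3 ∤ ord₃ j` (`ClassX4M.surj_of_not_dvd_padicValRat_j`; the
lane's `j3unit` bit) — MANIN-FREE imprimitive CT road on the `3 ∤ ord₃ j` rows.
[cite: KimNakamura2020, Rem. 1.8 (4) and Rem. 1.8 (1) with Thm. 1.7 (arXiv p. 4)] [cite: CesnaviciusNeururerSaha2023, Thm. 1.2]
[cite: SilvermanAEC2009, Thm. X.4.14] [cite: Miller2011LMS, §1 and Def. 1.1] -/
theorem ClassX4M.bsdp_three_rankZero_of_kimNakamuraImprimitive_of_not_dvd_padicValRat_j_of_casselsTate_of_pow_dvd_of_defect_le_one_of_not_dvd_modularDegree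
    (hKNI : KimNakamura2020.rankZero_padicValNat_sha_le_imprimitive_of_maninConstant)
    (hCNS : cesnaviciusNeururerSaha_padicVal_maninConstant_le_modularDegree)
    (hGZK : rank_eq_analyticRank_of_analyticRank_le_one) (hmod : hasEntireLFunction_rat)
    (hCT : exists_casselsTate_pairing (K := ℚ))
    (hX : ClassX4M W 3) (hj : ¬ (3 : ℤ) ∣ padicValRat 3 W.j) (hr : W.analyticRank = 0)
    (hexc : KimNakamura2020.NonExceptional W 3) (htam : ¬ 3 ∣ W.tamagawaProduct)
    [NeZero (W.conductorNorm ℤ)] (D : ModularParametrizationData W (W.conductorNorm ℤ))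
    (hdeg : ¬ 3 ∣ D.modularDegree) (S : Finset ℕ) (d : ℕ → ℕ)
    (hS : ∀ (ℓ : ℕ) [Fact ℓ.Prime], W.HasMultiplicativeReductionAtPrime ℓ →
      ℓ ∈ S ∧ (W.HasSplitMultiplicativeReductionAtPrime ℓ → padicValNat 3 (ℓ - 1) ≤ d ℓ) ∧
        (¬ W.HasSplitMultiplicativeReductionAtPrime ℓ → padicValNat 3 (ℓ + 1) ≤ d ℓ))
    (hd : ∑ ℓ ∈ S, d ℓ ≤ 1) {q : ℚ} (hq : shaAn W = (q : ℂ)) {k : ℕ}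
    (hv : padicValRat 3 q = 2 * k) (hdvd : 3 ^ (2 * k - 1) ∣ W.shaOrder) : BSDp W 3 :=
  haveI : Fact (Nat.Prime 3) := ⟨Nat.prime_three⟩
  hX.bsdp_three_rankZero_of_kimNakamuraImprimitive_of_surj_of_casselsTate_of_pow_dvd_of_defect_le_one_of_not_dvd_modularDegree
    hKNI hCNS hGZK hmod hCT (ClassX4M.surj_of_not_dvd_padicValRat_j hX (by exact_mod_cast hj)) hr hexc
    htam D hdeg S d hS hd hq hv hdvd

end Imprimitive

end Summit.BirchSwinnertonDyer.Rank1Residual.AdditivePotMult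

end
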